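import Mathlib.Analysis.Distribution.TemperedDistribution
import Literature.Analysis.FluidPDE.MildSolution
import Literature.Analysis.FluidPDE.LerayHopf
import Literature.Analysis.FluidPDE.SuitableWeak
import Literature.Analysis.FluidPDE.SelfSimilar
import Literature.Analysis.FunctionSpaces.Complexify
import Literature.Analysis.FunctionSpaces.BMO
import Literature.Analysis.FunctionSpaces.LittlewoodPaley
import Literature.Analysis.FluidPDE.CriticalSpaces
import HarnessLib

-- provenance: harness21/H21/H21/Statements/NS/CriticalRegularity.lean @ 89e2818 (interim HEAD d8f2665); M5 mechanical rewrite
/-!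
# Navier–Stokes in critical spaces: Koch–Tataru, Cheskidov–Shvydkoy, Gallagher–Koch–Planchon
(family: NS, statements **ns.S15**, **ns.S31**; trunk FluidKinetic, outline
`H21/Outlines/FluidKinetic.md`, item `NSCriticalRegularity`; namespace `Literature.NS`)

This file states, on `ℝ³ = EuclideanSpace ℝ (Fin 3)`,

* **ns.S15** — Koch–Tataru's theorem: for weakly divergence-free data `u₀` small in `BMO⁻¹`
  there is a unique small global mild solution in the path space `X` with norm
  `‖u‖_X = sup_{t>0} √t ‖u(t)‖_∞ + sup_{x, R>0} (R⁻³ ∫₀^{R²} ∫_{B(x,R)} |u|² dy dt)^{1/2}`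
  (`NS.eKochTataruNorm`, `NS.koch_tataru`);
* **ns.S31** — the two "largest critical space" results: Cheskidov–Shvydkoy's
  `B^{-1}_{∞,∞}` jump criterion for regularity of Leray–Hopf solutions
  (`NS.cheskidov_shvydkoy`) and the Gallagher–Koch–Planchon blow-up of the critical Besov norms
  `Ḃ^{-1+3/p}_{p,q}`, `3 < p, q < ∞`, at the maximal time of `NS(u₀)`, the mild solution in
  Gallagher–Koch–Planchon's path space `𝓛^{1:∞}_{p,q}[T < T*]`, with Albritton's `lim`
  strengthening — whose tree-class renderings `gkp_besov_blowup`, `albritton_besov_blowup` are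
  **deprecated (mis-stated)** since the verdict clean-up of 2026-08-15: the faithful statements,
  over GKP's own class, are recorded in the dedicated section below and wanted as the named facts
  `gkp_besov_blowup_pathSpace`, `albritton_besov_blowup_pathSpace`;
* the `rfl` bridges `NS.rescale_eq_nsRescale`, `NS.rescaleData_eq_nsRescaleData` between the
  G03 scaling maps of `Statements/NS/CriticalSpaces` and the T-FLUID maps of
  `Prelude/FluidKinetic/SelfSimilar` (review finding 7d).

## Sources

* H. Koch, D. Tataru, *Well-posedness for the Navier–Stokes equations*, Adv. Math. 157 (2001),
  Thm. 1 (characterisation of `BMO⁻¹`), Thm. 2 (small data global well-posedness), §1 (the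
  space `X`).
* A. Cheskidov, R. Shvydkoy, *The regularity of weak solutions of the 3D Navier–Stokes
  equations in `B^{-1}_{∞,∞}`*, Arch. Ration. Mech. Anal. 195 (2010), Thm. 3.1.
* I. Gallagher, G. Koch, F. Planchon, *Blow-up of critical Besov norms at a potential
  Navier–Stokes singularity*, Comm. Math. Phys. 343 (2016) 39–82 = arXiv:1407.4156 ("GKP"):
  Thm. 1 (arXiv p. 5); p. 4: the Duhamel equation (1.2), the maximal time (1.3), the path spaces
  `𝓛^{a:b}_{p,q}` ((1.6) arXiv = (1.5) CMP) with Rem. 1.3, existence and uniqueness of `NS(u₀)` in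
  `X_T = 𝓛^{1:∞}_{p,q}(T)` ((1.7) arXiv = (1.6) CMP).
* D. Albritton, *Blow-up criteria for the Navier–Stokes equations in non-endpoint critical
  Besov spaces*, Anal. PDE 11 (2018) 1415–1456 = arXiv:1612.04439: Thm. 1.1 (p. 4: the `limsup`
  of GKP is a limit) and Thm. 4.2 (pp. 20–21: the mild solution `NS(u₀)`, its two uniqueness
  classes `C([0,T]; Ḃ^{s_p}_{p,q}) ∩ L̃¹_T Ḃ^{s_p+2}_{p,q} ∩ L̃^∞_T Ḃ^{s_p}_{p,q}` and
  `K̊_p(Q_T) ∩ K̊_∞(Q_T) ∩ C((0,T]; L^p ∩ L^∞)`, and the characterisation (i) of `T*(u₀) < ∞` by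
  `lim_{t ↑ T*} ‖u(t)‖_{L^{p₀}} = ∞`, `p₀ ∈ [p, ∞]`).
* H. Bahouri, J.-Y. Chemin, R. Danchin, *Fourier Analysis and Nonlinear PDE* (2011) ("BCD"),
  §5.6 (Navier–Stokes in critical Besov spaces, Kato's space `K`).
* M. Fujii, *Sharp non-uniqueness for the Navier–Stokes equations in scaling critical spaces*,
  arXiv:2602.19846 (2026), Thm. 1.2 (N2), Rem. 1.3; H. Miura, *Remark on uniqueness of mild
  solutions to the Navier–Stokes equations*, J. Funct. Anal. 218 (2005) 110–129, Thm. 2.3 (the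
  two cautions behind the verdict clean-up below).

## H21 / Mathlib anchors

Mathlib (this pin) has no Navier–Stokes, `BMO⁻¹`, Besov or Koch–Tataru notions (searched
`Koch`, `Tataru`, `Besov`, `BMO`, `NavierStokes` in `Mathlib/`: nothing relevant); used from
Mathlib: `MeasureTheory.eLpNorm`, `MeasureTheory.lintegral` (`∫⁻`), `Metric.ball`,
`ENNReal.ofReal`, `Filter.limsup`, `𝓝[<] T`, `𝓝[>] 0`, `𝓝[S] t`, `=ᵐ[volume]`, tempered
distributions `𝓢'(E, F)` (`Mathlib/Analysis/Distribution/TemperedDistribution.lean`).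
From H21: `Fluid.IsGlobalMildSolution`, `Fluid.IsMildNSSolutionOn` (F8 `MildSolution`),
`Fluid.IsLerayHopfOn` (F5), `Fluid.IsClassicalNSSolutionOn` (F2), `Fluid.IsWeaklyDivFree` (F1),
`Fluid.nsRescale`, `Fluid.nsRescaleData` (F10 `SelfSimilar`), `MemBMOInvVec`, `eBMOInvNorm`,
`eBMOSeminormVec` (G03 `BMO`), `MemHomBesov`, `eHomBesovNorm` (G03 `LittlewoodPaley`),
`EuclideanSpace.complexify` (G03 `Complexify`) and, from the accepted
`Statements/NS/CriticalSpaces` (G03), `NS.IsDistributionOf`, `NS.rescale`, `NS.rescaleData`.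

## Design choices

* **Functions versus distributions.** Mild and Leray–Hopf solutions are honest functions
  `u : ℝ → ℝ³ → ℝ³`; the Besov norms live on `𝓢'(ℝ³, ℂ³)`. Following `CriticalSpaces`
  (finding 7d) every Besov-side hypothesis is phrased through a family of distributions
  `U : ℝ → 𝓢'(ℝ³, ℂ³)` with `hU : ∀ t, NS.IsDistributionOf (u t) (U t)`; Besov norms of
  increments are `eHomBesovNorm s p q (U t - U t₀)`. No `Lp.toTemperedDistribution` plumbing.
* **Vector `BMO⁻¹` norm.** The accepted `eBMOInvNorm` is scalar; the datum norm of Koch–Tataru's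
  Theorem 2 is `NS.eBMOInvNormVec u₀ := ⨆_{‖v‖ ≤ 1} ‖⟪u₀, v⟫‖_{BMO⁻¹}`, mirroring the accepted
  `eBMOSeminormVec`.
* **Koch–Tataru** is stated for viscosity `ν = 1` and zero force, as in the paper (general `ν`
  follows by scaling). "Unique small solution" is rendered as: existence of a global mild solution
  with `‖u‖_X ≤ ε` and `u(t) ∈ BMO⁻¹` for every `t ≥ 0`, and a.e.-uniqueness at every time
  `t ≥ 0` among global mild solutions `v` in the same class with `‖v‖_X ≤ ε` (uniqueness in the
  small ball of `X ∩ L^∞(BMO⁻¹)`, the fixed-point statement of Thm. 2). **Why the slice-wise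
  `BMO⁻¹` clause is needed.** The accepted duality-form mild predicate
  `Fluid.IsMildNSSolutionFrom` only tests slices against divergence-free test fields, and the
  `X`-norm neither sees the slice `t = 0` nor excludes spatially constant slices (Galilean drifts
  `u(t, · + ∫₀ᵗ c) + c(t)`), so without it a.e.-uniqueness would be false. Requiring
  `MemBMOInvVec (u t)` for all `t ≥ 0` (which is part of KT Thm. 2: `u ∈ L^∞(BMO⁻¹)`) kills
  constants and harmonic polynomial gradients (they have no bounded-mean-oscillation divergence
  representation) and makes the clause faithful; compare the accepted Kato uniqueness
  `IsMildNSSolutionOn.ae_eq_of_continuousInLpOn_three`, which gets this for free from `L³`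
  (outline finding 5). The hypothesis `MemBMOInvVec u₀` is implied by `‖u₀‖_{BMO⁻¹} ≤ δ < ∞`
  (accepted `memBMOInv_iff`, componentwise); it is kept as an explicit guard of the honest pairing.
* **Tempering guard on the datum** (review of attempt 1, finding 1). The duality form
  `Fluid.IsMildNSSolutionFrom` pairs the datum against caloric tests `e^{tΔ}φ` by a Bochner
  integral, which is `0` (junk) when the pairing is not integrable; `MemBMOInvVec u₀` alone puts
  no bound on the growth of `∫_{B(x,1)} |u₀|`, and for such wild data the existence clause of
  Koch–Tataru could even become *false* in the duality rendering. Hence `koch_tataru` and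
  `koch_tataru_bound` are stated for `BMO⁻¹` data with polynomially weighted `L¹` growth,
  `NS.IsPolynomiallyTempered u₀ : ∃ N, Integrable ((1 + ‖y‖²)^{-N} • u₀)` (the guard of the
  accepted `memBMOInv_iff_carleson_heat`), so that the caloric datum pairing is an honest,
  absolutely convergent integral. KT's Theorem 2 covers all of `BMO⁻¹`, so this is a strict
  specialisation, hence faithful. For GKP the `IsDistributionOf` hypothesis makes the datum term
  honest.
* **Naming.** The outline's `kochTataruPathNorm` is called `NS.eKochTataruNorm` (`e` prefix for
  `ℝ≥0∞`-valued norms, as `eLpNorm`, `eBMOInvNorm`, `eHomBesovNorm`; review of attempt 1).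
* **Cheskidov–Shvydkoy** use the *inhomogeneous* space `B^{-1}_{∞,∞}`; for the increments of an
  `L²`-valued Leray–Hopf solution the inhomogeneous norm is bounded by twice the homogeneous norm
  `Ḃ^{-1}_{∞,∞}` of `LittlewoodPaley.lean` (the low-frequency block is `∑_{j<0} Δ̇_j`, and
  `∑_{j<0} 2^{j} = 1`), so the statement with `eHomBesovNorm (-1) ∞ ∞` and an unspecified absolute
  constant `c` is implied by the printed theorem. "Regular on `(0, T]`" is rendered as in the
  accepted `ns.S07` (`Statements/NS/LerayHopf`): `u(t)` agrees a.e. with a classical solution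
  on the time set `Ioc 0 T`.
* **GKP's maximal time (original design, superseded — see the next section).** GKP's `NS(u₀)`
  is the mild solution built by fixed point in the path space `X_T = 𝓛^{1:∞}_{p,q}(T)`; the
  original rendering pinned it down, without importing the construction, by the class
  `IsBesovMildSolutionOn` (mild on `[0,T)` in the duality form, continuous in `Ḃ^{s}_{p,q}`
  through `IsDistributionOf`, and in Kato's class `K_∞`: `sup_{0<τ<t} √τ ‖u(τ)‖_∞ < ∞` with
  `√t ‖u(t)‖_∞ → 0` at `0⁺`) and maximality `IsMaximalBesovMildSolution` = no extension in this
  class to a longer interval, under the assumption that mild solutions are unique in this class.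
  That assumption is not a published theorem (next section); the two classes are kept (they are
  the vocabulary of a large file family) but the blow-up facts stated over them are deprecated,
  and the faithful statements are read over GKP's own class. GKP prove `limsup = ∞`; the full
  limit is Albritton 2018 (conclusion `Tendsto … (𝓝 ∞)` in `ℝ≥0∞`, not `atTop`, which in `ℝ≥0∞`
  would mean "eventually `= ∞`").
* For `p = ∞`, `p.toReal = 0` and `3 / 0 = 0` in Lean; here `3 < p < ∞` throughout, so the
  regularity index `-1 + 3 / p.toReal` is the honest `s_p = -1 + 3/p ∈ (-1, 0)`.

## Verdict clean-up (2026-08-15): GKP's solution class versus the tree's class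

**What is printed.** GKP, Thm. 1 (arXiv p. 5): *let `p, q ∈ (3, ∞)` and `u₀ ∈ Ḃ^{s_p}_{p,q}` be
divergence free; let `u = NS(u₀) ∈ 𝓛^{1:∞}_{p,q}[T < T*]` be the unique strong solution of the
Duhamel equation (1.2) with maximal time of existence `T*`; if `T* < ∞` then
`limsup_{t → T*} ‖u(t)‖_{Ḃ^{s_p}_{p,q}} = ∞`.* Here `NS(u₀)` is the unique solution of (1.2) in the
Chemin–Lerner path space `X_T = 𝓛^{1:∞}_{p,q}(T) = L̃¹((0,T); Ḃ^{s_p+2}_{p,q}) ∩ L̃^∞((0,T); Ḃ^{s_p}_{p,q})`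
(p. 4, (1.7): two solutions of (1.2) in `𝓛^{1:∞}_{p,q}(T)` coincide and lie in
`C([0,T]; Ḃ^{s_p}_{p,q}) ∩ C^∞(ℝ³ × (0,T])`) and `T* = T*_{𝓛^{1:∞}_{p,q}(T)}(u₀)` is its maximal time
in that class ((1.3)). Albritton, Thm. 1.1 (p. 4) upgrades `limsup` to `lim` for "the mild
solution … with initial data `u₀` and maximal time of existence `T*(u₀)`" of his Thm. 4.2, i.e.
the unique mild solution in `C([0,T]; Ḃ^{s_p}_{p,q}) ∩ L̃¹_T Ḃ^{s_p+2}_{p,q} ∩ L̃^∞_T Ḃ^{s_p}_{p,q}`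
(the same path space) for all `T < T*(u₀)`, which moreover lies in `K̊_p ∩ K̊_∞` and has
`‖u(t)‖_{L^∞} → ∞` as `t ↑ T*` when `T* < ∞` (Thm. 4.2 (i)).

**What was vendored, and what is wrong with it.** The original `gkp_besov_blowup` and
`albritton_besov_blowup` quantify over *every* `IsMaximalBesovMildSolution (-1+3/p) p q T ν u U`:
a duality-form mild solution in `C([0,T); Ḃ^{s_p}_{p,q}) ∩ K_∞` with no extension **in that
class**. This class asks no `L̃¹_T Ḃ^{s_p+2}_{p,q}` (nor `K̊_p`) control and is not a published
uniqueness class: continuity in the critical Besov space alone is not one — for `3 < p ≤ ∞` and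
every `1 ≤ q ≤ ∞` there are infinitely many mild solutions in `C([0,T); Ḃ^{3/p-1}_{p,q}(ℝ³))` from
small data, even from the datum `0` (Fujii 2026, Thm. 1.2 (N2); these solutions do *not* lie in
`L̃¹(0,T; Ḃ^{3/p+1}_{p,q})`, i.e. not in `𝓛^{1:∞}`, so there is no contradiction with the
uniqueness (1.7)) — and the printed uniqueness theorems for Kato-type
classes use an `L²`-in-time integrability at `t = 0` that `K_∞` does not supply (Miura 2005,
Thm. 2.3). So the vendored statements follow from their sources only together with the unprinted
identification "every `IsBesovMildSolutionOn` solution lies in `𝓛^{1:∞}_{p,q}[T' < T]`"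
(machine-checked dissections: `gkp_besov_blowup_iff_pathSpaceBlowup`,
`CriticalRegularityPathSpace.lean`; `albritton_besov_blowup_iff_pathSpaceTendsto`,
`AlbrittonBlowupCriterionPathSpace.lean`; audits `GKPRegularityPersistence.lean`,
`GKPCriticalElements.lean` §"GKP's solution class versus the tree's class"). They are
**mis-stated** (verdicts of their prove seats, re-verified here against arXiv:1407.4156 pp. 4–5
and arXiv:1612.04439 pp. 4, 20–23); nothing asserts that they are false.

**Disposition.** Both are **deprecated** (2026-08-15) and kept verbatim, statement unchanged,
because the conditional reductions of the file family take them as hypotheses or conclusions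
(`gkp_besov_blowup.biSup_eq_top`, `gkp_besov_blowup_iff_biSup`, `gkp_besov_blowup_of_albritton`
in `CriticalRegularityProofs.lean`; `gkp_besov_blowup_of_criticalElements`,
`GKPCriticalElements.lean`; `gkp_besov_blowup_of_gkp`, `gkp_besov_blowup_iff_gkp`,
`GKPCriticalElementsProofs.lean`; `gkp_besov_blowup_of_pathSpace`, `GKPRigidityProofs.lean`;
`albritton_besov_blowup_of_singular_point`, `AlbrittonBlowupCriterion.lean`;
`albritton_besov_blowup_iff_continuation`, `AlbrittonBlowupCriterionContinuation.lean`;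
`NSCriticalClosureBesov*.lean`, `NSBoundedMildOseenAssembly.lean`). This file has no in-file user
of either, so no linter is silenced here.

**The faithful statements** (over GKP's class; the **wanted named facts**
`gkp_besov_blowup_pathSpace` — to be cited as GKP2016, Thm. 1 — and
`albritton_besov_blowup_pathSpace` — to be cited as Albritton2018, Thm. 1.1 with Thm. 4.2; not
declared by this verdict clean-up, whose seat may not add named facts, D-0026, and left to
definition/cite items). With "GKP solution on `[0, T)`" := Besov mild solution of the critical
class `(s_p, p, q)` (`IsBesovMildSolutionOn`) whose distributions lie in `𝓛^{1:∞}_{p,q}[T' < T]`,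
i.e. `‖U‖_{𝓛^{1:∞}_{p,q}(0,T')} < ∞` for every `0 < T' < T` (the restriction of `NS(u 0)` to
`[0, T)`, `T ≤ T*`, by the uniqueness (1.7); in the tree: `IsGKPSolutionOn p q T ν u U` of
`GKPCriticalElements.lean`, equivalently `IsBesovMildSolutionOn … ∧ MemGKPPathSpace p q T U` with
`MemGKPPathSpace` of `GKPRegularityPersistence.lean`) and "`T = T* < ∞`" := `0 < T` and no GKP
solution on a longer interval extends it (`IsMaximalGKPSolution p q T ν u U`), they read

    gkp_besov_blowup_pathSpace : Prop :=      -- [cite: GKP2016, Thm. 1]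
      ∀ ⦃ν : ℝ⦄, 0 < ν → ∀ ⦃p q : ℝ≥0∞⦄ [Fact (1 ≤ p)], 3 < p → p < ∞ → 3 < q → q < ∞ →
        ∀ ⦃T : ℝ⦄, 0 < T → ∀ ⦃u : ℝ → ℝ³ → ℝ³⦄ ⦃U : ℝ → 𝓢'(ℝ³, ℂ³)⦄,
          IsMaximalGKPSolution p q T ν u U →
            limsup (fun t => eHomBesovNorm (-1 + 3 / p.toReal) p q (U t)) (𝓝[<] T) = ∞

    albritton_besov_blowup_pathSpace : Prop :=   -- [cite: Albritton2018, Thm. 1.1]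
      (the same binders) IsMaximalGKPSolution p q T ν u U →
            Tendsto (fun t => eHomBesovNorm (-1 + 3 / p.toReal) p q (U t)) (𝓝[<] T) (𝓝 ∞)

— every viscosity `ν > 0` (GKP and Albritton take `ν = 1`; apply the printed theorem to
`w(s, y) = ν⁻¹ u(s/ν, y)`, which preserves all the classes) and function-valued solutions seen
through their distributions (a specialisation of the printed distributional data), as everywhere
in this file family. They are, verbatim, the hypothesis `hT1` of
`gkp_rigidity_pathSpace_of_blowup_pathSpace` (`GKPCriticalElements.lean`) and, with the two
structures unfolded, the hypotheses `hP` of `gkp_besov_blowup_of_pathSpaceBlowup`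
(`CriticalRegularityPathSpace.lean`) and of `albritton_besov_blowup_of_pathSpaceTendsto`
(`AlbrittonBlowupCriterionPathSpace.lean`), which prove `hP → hId → <deprecated fact>` and, under
the identification `hId`, the equivalence. Since `IsMaximalGKPSolution` is declared downstream of
this file, the natural home of the two named facts is a file importing `GKPCriticalElements.lean`.
Albritton's second uniqueness class (Thm. 4.2: `K̊_p ∩ K̊_∞ ∩ C((0,T]; L^p ∩ L^∞)`) gives an
equivalent reading of "the mild solution"; its tree rendering is `IsMaximalKatoBesovMildSolution`
(`AlbrittonBlowupCriterionKato.lean`).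
-/

noncomputable section

open MeasureTheory TemperedDistribution Set Function Filter Topology Metric
open scoped SchwartzMap ENNReal NNReal RealInnerProductSpace

namespace Literature.Analysis.FluidPDE

/-! ## Bridges between the G03 and T-FLUID scaling maps -/

section Bridge

variable {E : Type*} [NormedAddCommGroup E] [NormedSpace ℝ E]

/-- The G03 scaling map `NS.rescale` (`Statements/NS/CriticalSpaces`) *is* the T-FLUID map
`Fluid.nsRescale` (`Prelude/FluidKinetic/SelfSimilar`), letter for letter (review finding 7d;
Koch–Tataru 2001, §1). [cite: KochTataru2001, §1] -/
theorem rescale_eq_nsRescale (c : ℝ) (u : ℝ → E → E) : rescale c u = FluidPDE.nsRescale c u := rfl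

/-- The G03 data scaling `NS.rescaleData` *is* the T-FLUID map `Fluid.nsRescaleData`, letter for
letter (review finding 7d; Koch–Tataru 2001, §1). [cite: KochTataru2001, §1] -/
theorem rescaleData_eq_nsRescaleData (c : ℝ) (u₀ : E → E) :
    rescaleData c u₀ = FluidPDE.nsRescaleData c u₀ := rfl

end Bridge

/-- Local notation for physical space `ℝ³ = EuclideanSpace ℝ (Fin 3)`. -/
local notation "ℝ³" => EuclideanSpace ℝ (Fin 3)

/-- Local notation for the complexified target `ℂ³ = EuclideanSpace ℂ (Fin 3)`. -/
local notation "ℂ³" => EuclideanSpace ℂ (Fin 3)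

/-! ## ns.S15: Koch–Tataru -/

section KochTataru

variable {E : Type*} [NormedAddCommGroup E] [InnerProductSpace ℝ E] [FiniteDimensional ℝ E]
  [MeasurableSpace E] [BorelSpace E]

/-- The **vector `BMO⁻¹` norm** of a field `u₀ : E → E`,
`‖u₀‖_{BMO⁻¹} = sup_{‖v‖ ≤ 1} ‖⟪u₀, v⟫‖_{BMO⁻¹} ∈ [0, ∞]` (Koch–Tataru 2001, Thm. 2: the norm
of the space of initial data; componentwise via the accepted scalar `eBMOInvNorm`, mirroring
`eBMOSeminormVec`). [cite: KochTataru2001, Thm. 2: the norm of the space of initial] -/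
def eBMOInvNormVec (u₀ : E → E) : ℝ≥0∞ :=
  ⨆ (v : E) (_ : ‖v‖ ≤ 1), FunctionSpaces.eBMOInvNorm (fun x => ⟪u₀ x, v⟫)

/-- The vector `BMO⁻¹` norm dominates the `BMO⁻¹` norm of every component `⟪u₀, v⟫`,
`‖v‖ ≤ 1` (definitional; Koch–Tataru 2001, §1). [cite: KochTataru2001, §1] -/
theorem eBMOInvNorm_inner_le_eBMOInvNormVec (u₀ : E → E) {v : E} (hv : ‖v‖ ≤ 1) :
    FunctionSpaces.eBMOInvNorm (fun x => ⟪u₀ x, v⟫) ≤ eBMOInvNormVec u₀ :=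
  le_iSup₂ (f := fun (v : E) (_ : ‖v‖ ≤ 1) => FunctionSpaces.eBMOInvNorm (fun x => ⟪u₀ x, v⟫)) v hv

/-- A field in `BMO⁻¹(E; E)` has finite vector `BMO⁻¹` norm: by linearity in `v` the supremum
over the unit ball is controlled by finitely many coordinate components, each finite by
`MemBMOInv.eBMOInvNorm_lt_top` (Koch–Tataru 2001, Thm. 1). [cite: KochTataru2001, Thm. 1] -/
def _root_.Literature.Analysis.FunctionSpaces.MemBMOInvVec.eBMOInvNormVec_lt_top : Prop :=
  ∀ {u₀ : E → E} (hu : FunctionSpaces.MemBMOInvVec u₀),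
    eBMOInvNormVec u₀ < ∞

/-- **ns.S15** (Koch–Tataru's path space `X`; Koch–Tataru 2001, §1 and Thm. 2). The
**Koch–Tataru norm** of a space–time field `u : ℝ → E → E` (time first),
`‖u‖_X = sup_{t>0} √t ‖u(t)‖_{L^∞} + sup_{x, R>0} (R^{-d} ∫₀^{R²} ∫_{B(x,R)} |u(t,y)|² dy dt)^{1/2}`
with `d = dim E` (`= 3` on `ℝ³`), valued in `[0, ∞]` (`⨆`, `∫⁻`, `eLpNorm` in `ℝ≥0∞`, no junk
values). The second summand is the Carleson-measure part, matching the accepted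
`BMOInv.eCarlesonNorm` of the caloric extension of the datum (Koch–Tataru 2001, (3)). [cite: KochTataru2001, §1 and Thm. 2] -/
def eKochTataruNorm (u : ℝ → E → E) : ℝ≥0∞ :=
  (⨆ (t : ℝ) (_ : 0 < t), ENNReal.ofReal (Real.sqrt t) * eLpNorm (u t) ∞ volume) +
    ⨆ (x : E) (R : ℝ) (_ : 0 < R),
      ((ENNReal.ofReal (R ^ Module.finrank ℝ E))⁻¹ *
        ∫⁻ t in Ioo 0 (R ^ 2), ∫⁻ y in ball x R, ‖u t y‖ₑ ^ 2) ^ (1 / 2 : ℝ)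

/-- The Koch–Tataru norm of the zero field vanishes (Koch–Tataru 2001, §1). [cite: KochTataru2001, §1] -/
@[simp]
theorem eKochTataruNorm_zero : eKochTataruNorm (0 : ℝ → E → E) = 0 := by
  simp [eKochTataruNorm, ENNReal.zero_rpow_of_pos]

/-- The `L^∞` part of the Koch–Tataru norm controls every slice:
`√t ‖u(t)‖_∞ ≤ ‖u‖_X` for `0 < t` (Koch–Tataru 2001, §1). [cite: KochTataru2001, §1] -/
theorem sqrt_mul_eLpNorm_le_eKochTataruNorm (u : ℝ → E → E) {t : ℝ} (ht : 0 < t) :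
    ENNReal.ofReal (Real.sqrt t) * eLpNorm (u t) ∞ volume ≤ eKochTataruNorm u :=
  le_add_right (le_iSup₂ (f := fun (t : ℝ) (_ : 0 < t) =>
    ENNReal.ofReal (Real.sqrt t) * eLpNorm (u t) ∞ volume) t ht)

/-- **Scale invariance of the path space** (Koch–Tataru 2001, §1: "`X` is invariant with respect
to the scaling"): `‖u_λ‖_X = ‖u‖_X` for the parabolic rescaling `u_λ = Fluid.nsRescale λ u`,
`0 < λ` (both summands are separately invariant: `√t · λ‖u(λ²t)‖_∞ = √(λ²t) ‖u(λ²t)‖_∞`, and the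
Carleson quantity by the change of variables `(t, y) ↦ (λ²t, λy)`). [cite: KochTataru2001, §1: " X  is invariant with respect to th] -/
def eKochTataruNorm_nsRescale : Prop :=
  ∀ (u : ℝ → E → E) {c : ℝ} (hc : 0 < c),
    eKochTataruNorm (FluidPDE.nsRescale c u) = eKochTataruNorm u

/-- The vector `BMO⁻¹` norm is invariant under the Navier–Stokes scaling of data on `ℝ³`
(Koch–Tataru 2001, §1), given the componentwise invariance `ns.S16`
`NS.eBMOInvNorm_rescaleData` as the hypothesis `h`. [cite: KochTataru2001, §1] -/
theorem eBMOInvNormVec_rescaleData (u₀ : ℝ³ → ℝ³) {c : ℝ}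
    (h : ∀ v : ℝ³, FunctionSpaces.eBMOInvNorm (fun x => ⟪rescaleData c u₀ x, v⟫) = FunctionSpaces.eBMOInvNorm (fun x => ⟪u₀ x, v⟫)) :
    eBMOInvNormVec (rescaleData c u₀) = eBMOInvNormVec u₀ := by
  simp only [eBMOInvNormVec, h]

/-- **Polynomially tempered fields**: `u₀ : E → E` is integrable against some polynomial weight
`(1 + ‖y‖²)^{-N}` (so `u₀` defines a tempered distribution and its caloric extension `e^{tΔ}u₀`,
as well as the pairings `∫ ⟪u₀, e^{tΔ}φ⟫` with Schwartz-class caloric tests, are absolutely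
convergent integrals). This is the vector version of the guard `htemp` of the accepted
`memBMOInv_iff_carleson_heat` (Koch–Tataru 2001, Thm. 1, "tempered distribution `u`"). [cite: KochTataru2001, Thm. 1  "tempered distribution  u "] -/
def IsPolynomiallyTempered (u₀ : E → E) : Prop :=
  ∃ N : ℕ, Integrable fun y => ((1 + ‖y‖ ^ 2) ^ N : ℝ)⁻¹ • u₀ y

/-- The zero field is polynomially tempered. [folklore] -/
theorem isPolynomiallyTempered_zero : IsPolynomiallyTempered (0 : E → E) :=
  ⟨0, by simp⟩

/-- An integrable field is polynomially tempered (take `N = 0`; Koch–Tataru 2001, §1). [cite: KochTataru2001, §1] -/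
theorem IsPolynomiallyTempered.of_integrable {u₀ : E → E}
    (hu : Integrable u₀) : IsPolynomiallyTempered u₀ :=
  ⟨0, by simpa using hu⟩

/-- **Koch–Tataru's solution class** (Koch–Tataru 2001, Thm. 2 and §1: global mild solutions in
`X ∩ L^∞((0,∞); BMO⁻¹)`): `u` is a global mild solution (duality form, viscosity `1`, zero
force) of the Navier–Stokes equations from `u₀`, measurable on `(0, ∞) × E`, and every slice
`u t`, `t ≥ 0`, lies in `BMO⁻¹(E; E)`. The last clause is part of KT's Theorem 2 and is what
excludes the spatially constant / harmonic-gradient slices invisible to the duality form (see the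
module docstring, §Design choices). Finiteness of `‖u‖_X` is *not* part of the class; it appears
quantitatively in the statements. [cite: KochTataru2001, Thm. 2 and §1: global mild solutions in] -/
structure IsKochTataruSolution (u₀ : E → E) (u : ℝ → E → E) : Prop where
  /-- `u` is a global mild solution with viscosity `1`, zero force and datum `u₀`. -/
  isGlobalMildSolution : FluidPDE.IsGlobalMildSolution 1 0 u₀ u
  /-- `u` is measurable on `(0, ∞) × E`. -/
  aestronglyMeasurable : AEStronglyMeasurable (uncurry u) (volume.restrict (Ioi 0 ×ˢ univ))
  /-- Every slice `u t`, `t ≥ 0`, is in `BMO⁻¹` (`u ∈ L^∞(BMO⁻¹)` qualitatively). -/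
  memBMOInvVec : ∀ t, 0 ≤ t → FunctionSpaces.MemBMOInvVec (u t)

/-- Every slice `u t`, `t ≥ 0`, of a Koch–Tataru solution is weakly divergence free
(projection of the mild predicate; Kato 1984, (1.7)). [cite: Kato1984, (1.7] -/
theorem IsKochTataruSolution.isWeaklyDivFree {u₀ : E → E} {u : ℝ → E → E}
    (h : IsKochTataruSolution u₀ u) {t : ℝ} (ht : 0 ≤ t) : FluidPDE.IsWeaklyDivFree (u t) :=
  h.isGlobalMildSolution.1 t ht

/-- **ns.S15** (Koch–Tataru, Adv. Math. 157 (2001), Thm. 2: small data global well-posedness in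
`BMO⁻¹`). There are absolute constants `δ, ε > 0` such that for every weakly divergence-free,
polynomially tempered `u₀ : ℝ³ → ℝ³` in `BMO⁻¹` with `‖u₀‖_{BMO⁻¹} ≤ δ`, the unforced
Navier–Stokes equations with viscosity `1` have a global mild solution `u` in Koch–Tataru's class
(`NS.IsKochTataruSolution`: duality-form mild, measurable on `(0, ∞) × ℝ³`, slices in `BMO⁻¹`)
lying in the path space `X` with `‖u‖_X ≤ ε` (small), and `u` is **unique in the small ball of
`X`**: every solution `v` in the same class from `u₀` with `‖v‖_X ≤ ε` agrees with `u` a.e. at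
every time `t ≥ 0`. The hypothesis `MemBMOInvVec u₀` is implied by the smallness bound (accepted
`memBMOInv_iff_eBMOInvNorm_lt_top`) and is kept as an explicit guard; the tempering hypothesis
`NS.IsPolynomiallyTempered u₀` (polynomially weighted `L¹` growth) makes the caloric datum
pairing of the duality form an honest integral — KT's theorem covers all of `BMO⁻¹`, so this is a
specialisation (module docstring, §Design choices). (Viscosity `ν = 1` as in the paper; for
general `ν > 0` apply the theorem to `w(s, x) = ν⁻¹ u(s/ν, x)`, whose datum has norm
`ν⁻¹‖u₀‖_{BMO⁻¹}`.) [cite: KochTataru2001, Thm. 2] -/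
def koch_tataru : Prop :=
  ∃ δ ε : ℝ, 0 < δ ∧ 0 < ε ∧ ∀ u₀ : ℝ³ → ℝ³, FluidPDE.IsWeaklyDivFree u₀ → FunctionSpaces.MemBMOInvVec u₀ →
      IsPolynomiallyTempered u₀ → eBMOInvNormVec u₀ ≤ ENNReal.ofReal δ →
      ∃ u : ℝ → ℝ³ → ℝ³, IsKochTataruSolution u₀ u ∧ eKochTataruNorm u ≤ ENNReal.ofReal ε ∧
        ∀ v : ℝ → ℝ³ → ℝ³, IsKochTataruSolution u₀ v → eKochTataruNorm v ≤ ENNReal.ofReal ε →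
          ∀ t, 0 ≤ t → v t =ᵐ[volume] u t

/-- **ns.S15** (Koch–Tataru 2001, Thm. 2, Lipschitz dependence on the data / smallness of the
solution): there are `δ, ε, C > 0` such that for every weakly divergence-free, polynomially
tempered `u₀` with `‖u₀‖_{BMO⁻¹} ≤ δ` some global solution `u` in Koch–Tataru's class satisfies
both `‖u‖_X ≤ ε` and `‖u‖_X ≤ C ‖u₀‖_{BMO⁻¹}` (the fixed-point map is a contraction on the
ball of radius `2C‖u₀‖_{BMO⁻¹}`; Koch–Tataru 2001, proof of Thm. 2). Only *some* class solution
is asserted to obey the bound; the printed proof gives it for the solution of `koch_tataru`.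
Same tempering specialisation as `koch_tataru`. [cite: KochTataru2001, Thm. 2  Lipschitz dependence on the data] -/
def koch_tataru_bound : Prop :=
  ∃ δ ε C : ℝ, 0 < δ ∧ 0 < ε ∧ 0 < C ∧ ∀ u₀ : ℝ³ → ℝ³, FluidPDE.IsWeaklyDivFree u₀ →
      FunctionSpaces.MemBMOInvVec u₀ → IsPolynomiallyTempered u₀ → eBMOInvNormVec u₀ ≤ ENNReal.ofReal δ →
      ∃ u : ℝ → ℝ³ → ℝ³, IsKochTataruSolution u₀ u ∧ eKochTataruNorm u ≤ ENNReal.ofReal ε ∧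
        eKochTataruNorm u ≤ ENNReal.ofReal C * eBMOInvNormVec u₀

end KochTataru

/-! ## ns.S31: the largest critical space `Ḃ^{-1}_{∞,∞}` and Besov blow-up -/

section CheskidovShvydkoy

/-- **ns.S31** (Cheskidov–Shvydkoy, Arch. Ration. Mech. Anal. 195 (2010), Thm. 3.1: regularity
criterion in the largest critical space `B^{-1}_{∞,∞}`). There is an absolute constant `c > 0`
such that: if `ν > 0`, `u` is a Leray–Hopf weak solution of the unforced Navier–Stokes equations
on `ℝ³ × [0, T)`, `U t ∈ 𝓢'(ℝ³, ℂ³)` is the tempered distribution of the slice `u t`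
(`NS.IsDistributionOf`, `t ∈ [0, T]`), and the left jumps of `u` in `Ḃ^{-1}_{∞,∞}` are uniformly
small, `sup_{t ∈ (0,T]} limsup_{t₀ → t⁻} ‖u(t) - u(t₀)‖_{Ḃ^{-1}_{∞,∞}} < c ν`, then `u` is
regular on `(0, T]`: there is a classical solution `(v, p')` on the time set `Ioc 0 T` with
`u(t) = v(t)` a.e. for every `t ∈ (0, T]` (same rendering of "regular" as `ns.S07`). In
particular `u ∈ C((0,T]; B^{-1}_{∞,∞})` suffices. See the module docstring for homogeneous versus
inhomogeneous `B^{-1}_{∞,∞}`. [cite: CheskidovShvydkoy2010, Thm. 3.1] -/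
def cheskidov_shvydkoy : Prop :=
  ∃ c : ℝ, 0 < c ∧ ∀ (ν T : ℝ), 0 < ν → 0 < T → ∀ (u₀ : ℝ³ → ℝ³) (u : ℝ → ℝ³ → ℝ³)
      (U : ℝ → 𝓢'(ℝ³, ℂ³)), FluidPDE.IsLerayHopfOn T ν 0 u₀ u →
      (∀ t ∈ Icc 0 T, IsDistributionOf (u t) (U t)) →
      (⨆ t ∈ Ioc 0 T, limsup (fun t₀ => FunctionSpaces.eHomBesovNorm (-1) ∞ ∞ (U t - U t₀)) (𝓝[<] t)) <
        ENNReal.ofReal (c * ν) →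
      ∃ (v : ℝ → ℝ³ → ℝ³) (p' : ℝ → ℝ³ → ℝ),
        FluidPDE.IsClassicalNSSolutionOn (Ioc 0 T) ν 0 v p' ∧ ∀ t ∈ Ioc 0 T, u t =ᵐ[volume] v t

end CheskidovShvydkoy

section GKP

variable {ι : Type*} [Fintype ι]

/-- `u ∈ C(S; Ḃ^s_{p,q})` for a real vector field `u : ℝ → ℝ^ι → ℝ^ι` seen through its family
of tempered distributions `U : ℝ → 𝓢'(ℝ^ι, ℂ^ι)`: every slice `U t`, `t ∈ S`, lies in
`Ḃ^s_{p,q}` (`MemHomBesov`) and `‖U t - U t₀‖_{Ḃ^s_{p,q}} → 0` as `t → t₀` within `S`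
(Gallagher–Koch–Planchon 2016, §1, the space `C([0,T); Ḃ^{s_p}_{p,q})`; BCD §5.6). Twin of
`Fluid.ContinuousInLpOn` / `Fluid.ContinuousInHomSobolevOn`. [cite: GallagherKochPlanchon2016, §1  the space  C( 0 T] -/
def ContinuousInHomBesovOn (S : Set ℝ) (s : ℝ) (p q : ℝ≥0∞) [Fact (1 ≤ p)]
    (U : ℝ → 𝓢'(EuclideanSpace ℝ ι, EuclideanSpace ℂ ι)) : Prop :=
  (∀ t ∈ S, FunctionSpaces.MemHomBesov s p q (U t)) ∧
    ∀ t₀ ∈ S, Tendsto (fun t => FunctionSpaces.eHomBesovNorm s p q (U t - U t₀)) (𝓝[S] t₀) (𝓝 0)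

/-- `ContinuousInHomBesovOn` is monotone in the time set (definitional). [folklore] -/
theorem ContinuousInHomBesovOn.mono {S S' : Set ℝ} {s : ℝ} {p q : ℝ≥0∞} [Fact (1 ≤ p)]
    {U : ℝ → 𝓢'(EuclideanSpace ℝ ι, EuclideanSpace ℂ ι)} (h : ContinuousInHomBesovOn S s p q U)
    (hS : S' ⊆ S) : ContinuousInHomBesovOn S' s p q U :=
  ⟨fun t ht => h.1 t (hS ht), fun t₀ ht₀ => (h.2 t₀ (hS ht₀)).mono_left (nhdsWithin_mono _ hS)⟩

/-- **Kato's class** `K_∞` on `[0, T)`: `sup_{0<τ<t} √τ ‖u(τ)‖_{L^∞} < ∞` for every `t < T` and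
`√t ‖u(t)‖_{L^∞} → 0` as `t → 0⁺` (Kato 1984, (1.2); BCD §5.6.1, Thm. 5.40: the auxiliary space
in which the critical-Besov mild solution is constructed and is unique). The second clause does
not depend on `T` (it only concerns `t → 0⁺`); this is harmless and used by `mono`. [cite: Kato1984, (1.2] -/
def MemKatoClassOn (T : ℝ) (u : ℝ → EuclideanSpace ℝ ι → EuclideanSpace ℝ ι) : Prop :=
  (∀ t < T, ⨆ τ ∈ Ioo 0 t, ENNReal.ofReal (Real.sqrt τ) * eLpNorm (u τ) ∞ volume < ∞) ∧
    Tendsto (fun t => ENNReal.ofReal (Real.sqrt t) * eLpNorm (u t) ∞ volume) (𝓝[>] 0) (𝓝 0)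

/-- Kato's class is monotone in the lifespan (definitional). [folklore] -/
theorem MemKatoClassOn.mono {T T' : ℝ} {u : ℝ → EuclideanSpace ℝ ι → EuclideanSpace ℝ ι}
    (h : MemKatoClassOn T u) (hT : T' ≤ T) : MemKatoClassOn T' u :=
  ⟨fun t ht => h.1 t (ht.trans_le hT), h.2⟩

/-- **Besov mild solutions on `[0, T)`** (Gallagher–Koch–Planchon 2016, §1, the solution
`NS(u₀) ∈ C([0,T); Ḃ^{s}_{p,q})`; BCD Thm. 5.40): `u` is an unforced mild solution on `[0, T)`
with viscosity `ν` and datum `u 0` (duality form), measurable on `(0,T) × ℝ^ι`, `U t` is the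
tempered distribution of `u t` for `t ∈ [0, T)`, `U ∈ C([0,T); Ḃ^s_{p,q})`, and `u` lies in
Kato's class `K_∞` on `[0, T)` (a property of the fixed-point solution, BCD Thm. 5.40 and
Albritton 2018, Thm. 4.2; it does **not** by itself single that solution out — this class is not
a published uniqueness class, see the module docstring, §Verdict clean-up; GKP's own class adds
membership in the path space `𝓛^{1:∞}_{p,q}[T' < T]`, `IsGKPSolutionOn` of
`GKPCriticalElements.lean`). [cite: GallagherKochPlanchon2016, §1.2 (the solution NS(u₀))] -/
structure IsBesovMildSolutionOn (s : ℝ) (p q : ℝ≥0∞) [Fact (1 ≤ p)] (T ν : ℝ)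
    (u : ℝ → EuclideanSpace ℝ ι → EuclideanSpace ℝ ι)
    (U : ℝ → 𝓢'(EuclideanSpace ℝ ι, EuclideanSpace ℂ ι)) : Prop where
  /-- `u` is a mild solution on `[0, T)` from its own initial slice (Kato 1984, (1.7)). -/
  mild : FluidPDE.IsMildNSSolutionOn (Ico 0 T) ν 0 (u 0) u
  /-- `u` is measurable on `(0, T) × ℝ^ι`. -/
  aestronglyMeasurable : AEStronglyMeasurable (uncurry u) (volume.restrict (Ioo 0 T ×ˢ univ))
  /-- `U t` is the tempered distribution of the slice `u t`, `t ∈ [0, T)`. -/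
  isDistributionOf : ∀ t ∈ Ico 0 T, IsDistributionOf (u t) (U t)
  /-- `U ∈ C([0,T); Ḃ^s_{p,q})` (GKP 2016, §1). -/
  continuousInHomBesovOn : ContinuousInHomBesovOn (Ico 0 T) s p q U
  /-- `u` is in Kato's class `K_∞` on `[0, T)` (BCD Thm. 5.40). -/
  memKatoClassOn : MemKatoClassOn T u

/-- Restriction of a Besov mild solution to a shorter lifespan `T' ≤ T` (definitional). [folklore] -/
theorem IsBesovMildSolutionOn.mono {s : ℝ} {p q : ℝ≥0∞} [Fact (1 ≤ p)] {T T' ν : ℝ}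
    {u : ℝ → EuclideanSpace ℝ ι → EuclideanSpace ℝ ι}
    {U : ℝ → 𝓢'(EuclideanSpace ℝ ι, EuclideanSpace ℂ ι)} (h : IsBesovMildSolutionOn s p q T ν u U)
    (hT : T' ≤ T) : IsBesovMildSolutionOn s p q T' ν u U where
  mild := h.mild.mono (Ico_subset_Ico_right hT)
  aestronglyMeasurable := h.aestronglyMeasurable.mono_measure
    (Measure.restrict_mono (prod_mono (Ioo_subset_Ioo_right hT) subset_rfl) le_rfl)
  isDistributionOf t ht := h.isDistributionOf t (Ico_subset_Ico_right hT ht)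
  continuousInHomBesovOn := h.continuousInHomBesovOn.mono (Ico_subset_Ico_right hT)
  memKatoClassOn := h.memKatoClassOn.mono hT

/-- The initial slice of a Besov mild solution on `[0, T)`, `0 < T`, is weakly divergence free
(projection of the mild predicate at `t = 0`; Kato 1984, (1.7)). [cite: Kato1984, (1.7] -/
theorem IsBesovMildSolutionOn.isWeaklyDivFree_zero {s : ℝ} {p q : ℝ≥0∞} [Fact (1 ≤ p)]
    {T ν : ℝ} {u : ℝ → EuclideanSpace ℝ ι → EuclideanSpace ℝ ι}
    {U : ℝ → 𝓢'(EuclideanSpace ℝ ι, EuclideanSpace ℂ ι)} (h : IsBesovMildSolutionOn s p q T ν u U)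
    (hT : 0 < T) : FluidPDE.IsWeaklyDivFree (u 0) :=
  h.mild.1 0 ⟨le_rfl, hT⟩

/-- **Maximal Besov mild solutions (maximality in the tree's class)**: `(u, U)` is a Besov mild
solution on `[0, T)` and there is no Besov mild solution `(v, V)` of the same class on a longer
interval `[0, T')`, `T' > T`, agreeing with `u` a.e. at every time of `[0, T)`. Meaningful for
`0 < T < ∞`. Modelled on GKP's maximal time `T*(u₀)` of `NS(u₀)` ((1.3)), but **not** the same
notion: GKP's `T*` is maximality in the path space `𝓛^{1:∞}_{p,q}` (tree rendering
`IsMaximalGKPSolution`, `GKPCriticalElements.lean`), and the two agree only under the unprinted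
identification of the classes (`isMaximalBesovMildSolution_iff_isMaximalGKPSolution` there; module
docstring, §Verdict clean-up). A maximal solution in this sense has in particular no extension in
GKP's class, and a Besov mild solution with `‖u(t)‖_{L^∞} → ∞` as `t ↑ T` is maximal in this sense
(`IsBesovMildSolutionOn.isMaximalBesovMildSolution_of_tendsto_eLpNorm_top`,
`AlbrittonBlowupCriterionPathSpace.lean`). [cite: GallagherKochPlanchon2016, (1.3) (the maximal time T*(u₀))] -/
structure IsMaximalBesovMildSolution (s : ℝ) (p q : ℝ≥0∞) [Fact (1 ≤ p)] (T ν : ℝ)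
    (u : ℝ → EuclideanSpace ℝ ι → EuclideanSpace ℝ ι)
    (U : ℝ → 𝓢'(EuclideanSpace ℝ ι, EuclideanSpace ℂ ι)) : Prop where
  /-- `(u, U)` is a Besov mild solution on `[0, T)`. -/
  isBesovMildSolutionOn : IsBesovMildSolutionOn s p q T ν u U
  /-- No Besov mild solution of the same class on a longer interval extends `u`. -/
  not_extendable : ¬ ∃ T' > T, ∃ (v : ℝ → EuclideanSpace ℝ ι → EuclideanSpace ℝ ι)
        (V : ℝ → 𝓢'(EuclideanSpace ℝ ι, EuclideanSpace ℂ ι)),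
      IsBesovMildSolutionOn s p q T' ν v V ∧ ∀ t ∈ Ico 0 T, v t =ᵐ[volume] u t

/-- A Besov mild solution on a longer interval `[0, T')`, `T < T'`, is not maximal with lifespan
`T` (it extends its own restriction; GKP 2016, §1). [cite: GKP2016, §1] -/
theorem IsBesovMildSolutionOn.not_isMaximalBesovMildSolution {s : ℝ} {p q : ℝ≥0∞}
    [Fact (1 ≤ p)] {T T' ν : ℝ} (hTT' : T < T')
    {u : ℝ → EuclideanSpace ℝ ι → EuclideanSpace ℝ ι}
    {U : ℝ → 𝓢'(EuclideanSpace ℝ ι, EuclideanSpace ℂ ι)}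
    (h : IsBesovMildSolutionOn s p q T' ν u U) : ¬ IsMaximalBesovMildSolution s p q T ν u U :=
  fun hmax => hmax.not_extendable ⟨T', hTT', u, U, h, fun _ _ => ae_eq_refl _⟩

/-- Local theory in critical Besov spaces (auxiliary to the GKP statement of ns.S31: Cannone
1995, Planchon 1996; BCD Thm. 5.40; Gallagher–Koch–Planchon 2016, §1, existence of `NS(u₀)`).
Let `ν > 0`, `3 < p < ∞`, `3 < q < ∞` (the GKP range), and let `u₀ : ℝ³ → ℝ³` be weakly
divergence free with tempered distribution `U₀ ∈ Ḃ^{-1+3/p}_{p,q}`. Then there are `T > 0` and a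
Besov mild solution `(u, U)` on `[0, T)` with `u 0 = u₀`. The instance `[Fact (1 ≤ p)]` is
redundant given `3 < p` but is the form in which `MemHomBesov`/`eHomBesovNorm` consume it. [cite: BahouriCheminDanchin2011, Thm. 5.40] -/
def exists_isBesovMildSolutionOn : Prop :=
  ∀ {ν : ℝ} (hν : 0 < ν) {p q : ℝ≥0∞} [Fact (1 ≤ p)] (hp₃ : 3 < p) (hp : p < ∞) (hq₃ : 3 < q) (hq : q < ∞) {u₀ : ℝ³ → ℝ³} {U₀ : 𝓢'(ℝ³, ℂ³)} (hdiv : FluidPDE.IsWeaklyDivFree u₀) (hU₀ : IsDistributionOf u₀ U₀) (hB : FunctionSpaces.MemHomBesov (-1 + 3 / p.toReal) p q U₀),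
    ∃ T : ℝ, 0 < T ∧ ∃ (u : ℝ → ℝ³ → ℝ³) (U : ℝ → 𝓢'(ℝ³, ℂ³)),
      IsBesovMildSolutionOn (-1 + 3 / p.toReal) p q T ν u U ∧ u 0 = u₀

/-! ### GKP Theorem 1 and Albritton Theorem 1.1: the deprecated tree-class renderings -/

/-- **Deprecated (2026-08-15) — mis-stated** (verdict of its prove seat, re-verified against
arXiv:1407.4156, pp. 4–5; the statement is kept verbatim, unchanged, because the conditional
reductions `gkp_besov_blowup.biSup_eq_top`, `gkp_besov_blowup_iff_biSup`,
`gkp_besov_blowup_of_albritton` (`CriticalRegularityProofs.lean`),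
`gkp_besov_blowup_of_criticalElements` (`GKPCriticalElements.lean`), `gkp_besov_blowup_of_gkp`,
`gkp_besov_blowup_iff_gkp` (`GKPCriticalElementsProofs.lean`), `gkp_besov_blowup_of_pathSpace`
(`GKPRigidityProofs.lean`), `gkp_besov_blowup_of_pathSpaceBlowup`
(`CriticalRegularityPathSpace.lean`) and `NSCriticalClosureBesov*.lean`,
`NSBoundedMildOseenAssembly.lean` take it as a hypothesis or a conclusion). *Intended:* GKP 2016,
Thm. 1 (blow-up of the critical Besov norms `Ḃ^{-1+3/p}_{p,q}`, `3 < p, q < ∞`, at a finite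
maximal time). *What is wrong:* in print the theorem concerns `NS(u₀)`, the unique solution of
the Duhamel equation (1.2) in the path space `𝓛^{1:∞}_{p,q}[T < T*]` ((1.7)), and `T*` is its
maximal time in that class ((1.3)); this `Prop` quantifies instead over every
`IsMaximalBesovMildSolution (-1+3/p) p q T ν u U` — a duality-form mild solution in
`C([0,T); Ḃ^{s_p}_{p,q}) ∩ K_∞` with no extension *in that class* — which is not a published
uniqueness class (Fujii 2026, Thm. 1.2 (N2); Miura 2005, Thm. 2.3), so the statement follows from
its source only together with the unprinted identification "every `IsBesovMildSolutionOn`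
solution lies in `𝓛^{1:∞}_{p,q}[T' < T]`" — machine-checked: `gkp_besov_blowup_of_pathSpaceBlowup`,
`pathSpaceBlowup_of_gkp_besov_blowup`, `gkp_besov_blowup_iff_pathSpaceBlowup`
(`CriticalRegularityPathSpace.lean`: this `Prop` = the faithful statement + the identification,
and under the identification the two are equivalent). *The faithful statement* (Thm. 1 over GKP's
class `IsMaximalGKPSolution`; wanted named fact `gkp_besov_blowup_pathSpace`, hypothesis `hT1` of
`gkp_rigidity_pathSpace_of_blowup_pathSpace`, `GKPCriticalElements.lean`, verbatim — see the
module docstring, §Verdict clean-up):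
`∀ {ν}, 0 < ν → ∀ {p q} [Fact (1 ≤ p)], 3 < p → p < ∞ → 3 < q → q < ∞ → ∀ {T}, 0 < T →
∀ {u U}, IsMaximalGKPSolution p q T ν u U → limsup (fun t => ‖U t‖_{Ḃ^{-1+3/p}_{p,q}}) (𝓝[<] T) = ∞`.
*Original content (unchanged):* let `ν > 0`, `3 < p, q < ∞`, and let `(u, U)` be a maximal Besov
mild solution of the unforced Navier–Stokes equations on `ℝ³ × [0, T)` in
`C([0,T); Ḃ^{-1+3/p}_{p,q})` (tree's class) with finite lifespan `0 < T < ∞`; then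
`limsup_{t → T⁻} ‖U t‖_{Ḃ^{-1+3/p}_{p,q}} = ∞`. [cite: GKP2016, Thm. 1] -/
@[deprecated "mis-stated (2026-08-15): GKP 2016 Thm. 1 concerns NS(u₀), the unique solution of (1.2) in the path space 𝓛^{1:∞}_{p,q}[T<T*], and its maximal time in that class, but this Prop quantifies over the tree's class IsMaximalBesovMildSolution (duality-form mild, C_t Ḃ^{s_p}_{p,q} ∩ K_∞, maximal in that class — not a published uniqueness class); it is the faithful statement + the unprinted identification of the classes (gkp_besov_blowup_iff_pathSpaceBlowup, CriticalRegularityPathSpace.lean). Faithful form: hypothesis `hT1` of Literature.Analysis.FluidPDE.gkp_rigidity_pathSpace_of_blowup_pathSpace (Thm. 1 over IsMaximalGKPSolution) = hypothesis `hP` of Literature.Analysis.FluidPDE.gkp_besov_blowup_of_pathSpaceBlowup, wanted as named fact gkp_besov_blowup_pathSpace" (since := "2026-08-15")]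
def gkp_besov_blowup : Prop :=
  ∀ {ν : ℝ} (hν : 0 < ν) {p q : ℝ≥0∞} [Fact (1 ≤ p)] (hp₃ : 3 < p) (hp : p < ∞) (hq₃ : 3 < q) (hq : q < ∞) {T : ℝ} (hT : 0 < T) {u : ℝ → ℝ³ → ℝ³} {U : ℝ → 𝓢'(ℝ³, ℂ³)} (hmax : IsMaximalBesovMildSolution (-1 + 3 / p.toReal) p q T ν u U),
    limsup (fun t => FunctionSpaces.eHomBesovNorm (-1 + 3 / p.toReal) p q (U t)) (𝓝[<] T) = ∞

/-- **Deprecated (2026-08-15) — mis-stated** (verdict of its prove seat, re-verified against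
arXiv:1612.04439, p. 4 (Thm. 1.1) and pp. 20–23 (Thm. 4.2 and its proof, Step 4); the statement is
kept verbatim, unchanged, because the conditional reductions `gkp_besov_blowup_of_albritton`
(`CriticalRegularityProofs.lean`), `albritton_besov_blowup_of_singular_point`,
`albritton_besov_blowup.not_frequently_le` (`AlbrittonBlowupCriterion.lean`),
`albritton_besov_blowup_iff_continuation` (`AlbrittonBlowupCriterionContinuation.lean`),
`albritton_besov_blowup_of_pathSpaceTendsto`, `albritton_besov_blowup.tendsto_of_tendsto_eLpNorm_top`
(`AlbrittonBlowupCriterionPathSpace.lean`) and `NSCriticalClosureBesov*.lean` take it as a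
hypothesis or a conclusion). *Intended:* Albritton 2018, Thm. 1.1 (at a finite maximal time the
critical Besov norm tends to infinity). *What is wrong:* in print the theorem concerns "the mild
solution … with initial data `u₀` and maximal time of existence `T*(u₀)`" of Thm. 4.2, unique in
the path space `C([0,T]; Ḃ^{s_p}_{p,q}) ∩ L̃¹_T Ḃ^{s_p+2}_{p,q} ∩ L̃^∞_T Ḃ^{s_p}_{p,q}` (and in
`K̊_p ∩ K̊_∞ ∩ C((0,T]; L^p ∩ L^∞)`); this `Prop` quantifies instead over every
`IsMaximalBesovMildSolution (-1+3/p) p q T ν u U` (duality-form mild, `C_t Ḃ^{s_p}_{p,q} ∩ K_∞`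
only, no extension in that class), which is neither of Albritton's uniqueness classes nor a
published one (Fujii 2026, Thm. 1.2 (N2); Miura 2005, Thm. 2.3). Since `NS(u₀)` with `T* < ∞`
*is* maximal in the tree's sense (Thm. 4.2 (i) with `p₀ = ∞`;
`albritton_besov_blowup.tendsto_of_tendsto_eLpNorm_top`), this `Prop` implies the printed theorem
and asserts it, in addition, for every unidentified member of the larger class: it is stated
stronger than its source, and follows from it only together with the unprinted identification of
the classes — machine-checked: `albritton_besov_blowup_of_pathSpaceTendsto`,
`pathSpaceTendsto_of_albritton_besov_blowup`, `albritton_besov_blowup_iff_pathSpaceTendsto`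
(`AlbrittonBlowupCriterionPathSpace.lean`). *The faithful statement* (Thm. 1.1 over the same
class `IsMaximalGKPSolution`; wanted named fact `albritton_besov_blowup_pathSpace`, hypothesis
`hP` of `albritton_besov_blowup_of_pathSpaceTendsto` with `IsBesovMildSolutionOn ∧ MemGKPPathSpace`
packaged as `IsGKPSolutionOn` — see the module docstring, §Verdict clean-up):
`∀ {ν}, 0 < ν → ∀ {p q} [Fact (1 ≤ p)], 3 < p → p < ∞ → 3 < q → q < ∞ → ∀ {T}, 0 < T →
∀ {u U}, IsMaximalGKPSolution p q T ν u U → Tendsto (fun t => ‖U t‖_{Ḃ^{-1+3/p}_{p,q}}) (𝓝[<] T) (𝓝 ∞)`.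
*Original content (unchanged):* under the hypotheses of `gkp_besov_blowup` (tree's class),
`‖U t‖_{Ḃ^{-1+3/p}_{p,q}} → ∞` as `t → T⁻` (a genuine limit, in `ℝ≥0∞`).
[cite: Albritton2018, Thm. 1.1] -/
@[deprecated "mis-stated (2026-08-15): Albritton 2018 Thm. 1.1 concerns the mild solution NS(u₀) of his Thm. 4.2 (unique in C_T Ḃ^{s_p}_{p,q} ∩ L̃¹_T Ḃ^{s_p+2}_{p,q} ∩ L̃^∞_T Ḃ^{s_p}_{p,q}) and its maximal time, but this Prop quantifies over the tree's class IsMaximalBesovMildSolution (duality-form mild, C_t Ḃ^{s_p}_{p,q} ∩ K_∞ only, maximal in that class — not a published uniqueness class); it is the faithful statement + the unprinted identification of the classes (albritton_besov_blowup_iff_pathSpaceTendsto, AlbrittonBlowupCriterionPathSpace.lean). Faithful form: hypothesis `hP` of Literature.Analysis.FluidPDE.albritton_besov_blowup_of_pathSpaceTendsto (Thm. 1.1 over GKP's path-space class, = IsMaximalGKPSolution), wanted as named fact albritton_besov_blowup_pathSpace" (since := "2026-08-15")]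
def albritton_besov_blowup : Prop :=
  ∀ {ν : ℝ} (hν : 0 < ν) {p q : ℝ≥0∞} [Fact (1 ≤ p)] (hp₃ : 3 < p) (hp : p < ∞) (hq₃ : 3 < q) (hq : q < ∞) {T : ℝ} (hT : 0 < T) {u : ℝ → ℝ³ → ℝ³} {U : ℝ → 𝓢'(ℝ³, ℂ³)} (hmax : IsMaximalBesovMildSolution (-1 + 3 / p.toReal) p q T ν u U),
    Tendsto (fun t => FunctionSpaces.eHomBesovNorm (-1 + 3 / p.toReal) p q (U t)) (𝓝[<] T) (𝓝 ∞)

end GKP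

end Literature.Analysis.FluidPDE
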